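import Summits.BirchSwinnertonDyer.BirchSwinnertonDyer.Theorems.KimAtThreeDeepLowerExpStarOmegaRes
import Summits.BirchSwinnertonDyer.BirchSwinnertonDyer.Theorems.KimAtThreeDeepLowerExpStarOmegaTower
import Summits.BirchSwinnertonDyer.BirchSwinnertonDyer.Theorems.KimAtThreeDeepLowerExpStarOmegaPlace
import Literature.NumberTheory.AdelicBaseChange.CompletionBaseChange
import HarnessLib

/-!
# (RES₀) of hKatoV2₀ is KERNEL: w2-c2's `exp*`-restriction theorem instantiated at `ℚ_v ⊆ L_{w₀}`
# (crux `KatoKuriharaPortThreeShared`, stmt-BirchSwinnertonDyer-19560; cell `bsd-addord`, seat w2-acc5 gen 5;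
# route W2 `KimAtThreeKolyvagin`; `--supports 19560`, helper)

HONEST FRAMING.  TOOL theorems only (no definition, no named fact, no instance, no `sorry`); general prime
`p`, general number field `L` and place `w₀ ∣ p`; closes nothing; nothing is booked; BSD is not proved by
any of this.  §3 is CONDITIONAL on the tree's named fact `PAdicHodge.nonempty_neronDeRhamDatum` (taken as a
hypothesis, displayed).

WHAT.  hKatoV2₀ (kim3 `KimAtThreeFineKatoPerFactorPartsSingle`, p508902) displays, per level and chosen place
`w₀`, the clause **(RES₀)** «`∃ dw, exp*_{dw} ∘ res_{L_{w₀}/ℚ_v} = (ℚ_v → L_{w₀}) ∘ exp*_d`» for the DEFINED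
dual exponentials (`expStarOmegaHom` at `L_{w₀}`, `expStarOmegaAt` at `v`).  This is w2-c2 g8's KERNEL theorem
`KimAtThreeDeepLowerExpStarOmegaRes.exists_localNeronLine_expStarOmega_res` (general `p`-adic `K ⊆ L`) read
across the `Place.Completion (inr v) / v.adicCompletion ℚ` seam at `K = ℚ_v`, `L = L_{w₀}`,
`r = galRestrictPlace v`:

* §1 `isScalarTower_padic_place_adicCompletion'` — `ℚ_p → ℚ_v → L_{w₀}` is a scalar tower for the canonical
  `ℚ_p`-structures (uniqueness of the continuous `ℚ_p → L_{w₀}`; `ℚ_v → L_{w₀}` continuous by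
  `adicCompletionSemialgHom_continuous`).
* §2 `exists_localNeronLine_res_single` — **(RES₀) VERBATIM in hKatoV2₀'s currency** from a Néron line `d`
  at `v`, the Prop-1.2.3 binders at `v`, and the existence of SOME Néron line at `w₀` (`Nonempty`).
* §3 `exists_localNeronLine_res_single_of_neronDeRhamDatum` — the same with the `Nonempty` input supplied
  from `nonempty_neronDeRhamDatum` BY NAME (w2-c2 `…ExpStarOmegaTower`).

So a print-side package hKatoP may display (DEF₀) in the form «`∀ dw`, (RES₀)(d, dw) → (DEF₀)(dw)» and the
assembler discharges hKatoV2₀'s `∃ dw … (RES₀) ∧ (DEF₀)` with §2/§3.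

References: K. Kato, LNM 1553 (1993) Ch. II §1.2.4, Prop. 1.2.3 [Kato1993LNM1553]; O. Brinon, B. Conrad,
*CMI notes* (2009) Prop. 6.3.8 [BrinonConrad2009]; J.-P. Serre, *Local Fields* (1979) II §3, §5
[SerreLocalFields1979].
-/

noncomputable section

-- the cell's Theorems namespace `Summit.BirchSwinnertonDyer.BirchSwinnertonDyer.…` repeats the summit name by design (D-0017)
set_option linter.dupNamespace false

open scoped NumberField
open Field ValuativeRel Function IsDedekindDomain NumberField
open Literature.NumberTheory.GaloisRepresentations Literature.NumberTheory.GaloisRepresentations.PeriodRingData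
open Literature.NumberTheory.PAdicHodge Literature.NumberTheory.EllipticCurves
open Summit.BirchSwinnertonDyer.Rank1Residual.GaloisImage
open Summit.BirchSwinnertonDyer.BirchSwinnertonDyer.Theorems.KimAtThreeDeepLowerExpStarOmega
open Summit.BirchSwinnertonDyer.BirchSwinnertonDyer.Theorems.KimAtThreeDeepLowerExpStarOmegaPlace
open Summit.BirchSwinnertonDyer.BirchSwinnertonDyer.Theorems.KimAtThreeDeepLowerExpStarOmegaRes
open Summit.BirchSwinnertonDyer.BirchSwinnertonDyer.Theorems.KimAtThreeDeepLowerExpStarOmegaTower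

namespace Summit.BirchSwinnertonDyer.BirchSwinnertonDyer.Theorems.KimAtThreeFineKatoExpStarResSingle

variable (W : WeierstrassCurve ℚ) [W.IsElliptic] (p : ℕ) [hp : Fact p.Prime]
  (L : Type) [Field L] [NumberField L]
  (w₀ : ((Rat.HeightOneSpectrum.primesEquiv (R := 𝓞 ℚ)).symm ⟨p, Fact.out⟩).Extension (𝓞 L))
  (hv₀ : ((p : ℕ) : 𝓞 ℚ) ∈ ((Rat.HeightOneSpectrum.primesEquiv (R := 𝓞 ℚ)).symm ⟨p, Fact.out⟩).asIdeal)
  (hw₀ : ((p : ℕ) : 𝓞 L) ∈ w₀.1.asIdeal)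

/-! ## §1. `ℚ_p → ℚ_v → L_{w₀}` is a scalar tower -/

omit [W.IsElliptic] in
set_option backward.isDefEq.respectTransparency false in
/-- **`ℚ_p → ℚ_v → L_{w₀}` is a scalar tower** for `padicAlgebraPlace` on `ℚ_v` and
`LocalField.adicCompletionPadicAlgebra` on `L_{w₀}`, given the continuity of `ℚ_v → L_{w₀}` (both `ℚ_p`-structures
are the unique continuous ones). [cite: SerreLocalFields1979, Ch. II §3] -/
theorem isScalarTower_padic_place_adicCompletion' :
    haveI : Fact (((p : ℕ) : 𝓞 ℚ) ∈ ((Rat.HeightOneSpectrum.primesEquiv (R := 𝓞 ℚ)).symm ⟨p, Fact.out⟩).asIdeal) := ⟨hv₀⟩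
    letI := topologicalSpacePlace ((Rat.HeightOneSpectrum.primesEquiv (R := 𝓞 ℚ)).symm ⟨p, Fact.out⟩)
    letI := padicAlgebraPlace p ((Rat.HeightOneSpectrum.primesEquiv (R := 𝓞 ℚ)).symm ⟨p, Fact.out⟩)
    letI := LocalField.adicCompletionPadicAlgebra w₀.1 p hw₀
    ∀ [Algebra (Place.Completion (Sum.inr ((Rat.HeightOneSpectrum.primesEquiv (R := 𝓞 ℚ)).symm ⟨p, Fact.out⟩)))
        (w₀.1.adicCompletion L)],
      Continuous (algebraMap (Place.Completion (Sum.inr ((Rat.HeightOneSpectrum.primesEquiv (R := 𝓞 ℚ)).symm ⟨p, Fact.out⟩)))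
        (w₀.1.adicCompletion L)) →
      IsScalarTower ℚ_[p] (Place.Completion (Sum.inr ((Rat.HeightOneSpectrum.primesEquiv (R := 𝓞 ℚ)).symm ⟨p, Fact.out⟩)))
        (w₀.1.adicCompletion L) := by
  intro _ hcont
  haveI : Fact (((p : ℕ) : 𝓞 ℚ) ∈ ((Rat.HeightOneSpectrum.primesEquiv (R := 𝓞 ℚ)).symm ⟨p, Fact.out⟩).asIdeal) := ⟨hv₀⟩
  letI := topologicalSpacePlace ((Rat.HeightOneSpectrum.primesEquiv (R := 𝓞 ℚ)).symm ⟨p, Fact.out⟩)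
  letI := padicAlgebraPlace p ((Rat.HeightOneSpectrum.primesEquiv (R := 𝓞 ℚ)).symm ⟨p, Fact.out⟩)
  letI := LocalField.adicCompletionPadicAlgebra w₀.1 p hw₀
  refine IsScalarTower.of_algebraMap_eq' ?_
  exact (LocalField.eq_algebraMap_adicCompletionPadicAlgebra w₀.1 p hw₀ _
    (hcont.comp (LocalField.continuous_algebraMap_adicCompletionPadicAlgebra
      ((Rat.HeightOneSpectrum.primesEquiv (R := 𝓞 ℚ)).symm ⟨p, Fact.out⟩) p hv₀))).symm

/-! ## §2. (RES₀) in hKatoV2₀'s currency -/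

set_option backward.isDefEq.respectTransparency false in
/-- **(RES₀) VERBATIM ⟸ w2-c2's (RES).**  For a Néron line `d` at `v ∣ p` with the Prop-1.2.3 binders at `v`
and SOME Néron line at `w₀` (`dim D⁰_dR = 1` over `L_{w₀}`), there is a Néron line `dw` at `w₀` with
`expStarOmegaHom … dw … (res h) = (ℚ_v → L_{w₀}) (expStarOmegaAt d h)` for every class `h ∈ H¹(ℚ_v, T_pW)`
and all Prop-1.2.3 binders at `w₀` (`exists_localNeronLine_expStarOmega_res` at `K = ℚ_v`, `L = L_{w₀}`,
`r = galRestrictPlace v`; `IsScalarTower` by §1, continuity by `adicCompletionSemialgHom_continuous`).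
[cite: Kato1993LNM1553, Ch. II §1.2.4 and Prop. 1.2.3] [cite: BrinonConrad2009, Prop. 6.3.8] -/
theorem exists_localNeronLine_res_single :
    haveI : Fact (((p : ℕ) : 𝓞 ℚ) ∈ ((Rat.HeightOneSpectrum.primesEquiv (R := 𝓞 ℚ)).symm ⟨p, Fact.out⟩).asIdeal) := ⟨hv₀⟩
    letI := valuativeRelPlace ((Rat.HeightOneSpectrum.primesEquiv (R := 𝓞 ℚ)).symm ⟨p, Fact.out⟩)
    letI := topologicalSpacePlace ((Rat.HeightOneSpectrum.primesEquiv (R := 𝓞 ℚ)).symm ⟨p, Fact.out⟩)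
    haveI := isNonarchimedeanLocalField_place ((Rat.HeightOneSpectrum.primesEquiv (R := 𝓞 ℚ)).symm ⟨p, Fact.out⟩)
    haveI := charZero_place ((Rat.HeightOneSpectrum.primesEquiv (R := 𝓞 ℚ)).symm ⟨p, Fact.out⟩)
    letI := padicAlgebraPlace p ((Rat.HeightOneSpectrum.primesEquiv (R := 𝓞 ℚ)).symm ⟨p, Fact.out⟩)
    haveI := fact_not_isUnit_place p ((Rat.HeightOneSpectrum.primesEquiv (R := 𝓞 ℚ)).symm ⟨p, Fact.out⟩)
    haveI := isAdicComplete_place p ((Rat.HeightOneSpectrum.primesEquiv (R := 𝓞 ℚ)).symm ⟨p, Fact.out⟩)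
    letI := LocalField.charZero_adicCompletion w₀.1
    letI := LocalField.adicCompletionPadicAlgebra w₀.1 p hw₀
    haveI : Fact (¬ IsUnit ((p : ℕ) : integerC (w₀.1.adicCompletion L))) :=
      ⟨not_isUnit_natCast_integerC (LocalField.valuation_adicCompletion_natCast_lt_one w₀.1 p hw₀)⟩
    haveI := isAdicComplete_integerC_natCast (LocalField.valuation_adicCompletion_natCast_lt_one w₀.1 p hw₀)
    ∀ (d : LocalNeronLineAt W p ((Rat.HeightOneSpectrum.primesEquiv (R := 𝓞 ℚ)).symm ⟨p, Fact.out⟩))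
      (hinj : (bdRPeriodRingData (valuation_place_lt_one p ((Rat.HeightOneSpectrum.primesEquiv (R := 𝓞 ℚ)).symm ⟨p, Fact.out⟩))).CupLogInjective (logCyclotomic p)
        (localRationalTateRep W p (galRestrictPlace ((Rat.HeightOneSpectrum.primesEquiv (R := 𝓞 ℚ)).symm ⟨p, Fact.out⟩))))
      (hex : ∀ z : contOneCocycles (localRationalTateRep W p (galRestrictPlace ((Rat.HeightOneSpectrum.primesEquiv (R := 𝓞 ℚ)).symm ⟨p, Fact.out⟩))).toTopRep,
        (bdRPeriodRingData (valuation_place_lt_one p ((Rat.HeightOneSpectrum.primesEquiv (R := 𝓞 ℚ)).symm ⟨p, Fact.out⟩))).HasDualExp (logCyclotomic p)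
          (localRationalTateRep W p (galRestrictPlace ((Rat.HeightOneSpectrum.primesEquiv (R := 𝓞 ℚ)).symm ⟨p, Fact.out⟩))) fun σ => z.1 σ),
      Nonempty (LocalNeronLine W (LocalField.valuation_adicCompletion_natCast_lt_one w₀.1 p hw₀)
        ((galRestrictPlace ((Rat.HeightOneSpectrum.primesEquiv (R := 𝓞 ℚ)).symm ⟨p, Fact.out⟩)).comp
          (absGaloisRestrict (((Rat.HeightOneSpectrum.primesEquiv (R := 𝓞 ℚ)).symm ⟨p, Fact.out⟩).adicCompletion ℚ) (w₀.1.adicCompletion L)))) →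
      ∃ dw : LocalNeronLine W (LocalField.valuation_adicCompletion_natCast_lt_one w₀.1 p hw₀)
          ((galRestrictPlace ((Rat.HeightOneSpectrum.primesEquiv (R := 𝓞 ℚ)).symm ⟨p, Fact.out⟩)).comp
            (absGaloisRestrict (((Rat.HeightOneSpectrum.primesEquiv (R := 𝓞 ℚ)).symm ⟨p, Fact.out⟩).adicCompletion ℚ) (w₀.1.adicCompletion L))),
        ∀ (hinjw : (bdRPeriodRingData (LocalField.valuation_adicCompletion_natCast_lt_one w₀.1 p hw₀)).CupLogInjective
            (logCyclotomic p) (localRationalTateRep W p ((galRestrictPlace ((Rat.HeightOneSpectrum.primesEquiv (R := 𝓞 ℚ)).symm ⟨p, Fact.out⟩)).comp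
              (absGaloisRestrict (((Rat.HeightOneSpectrum.primesEquiv (R := 𝓞 ℚ)).symm ⟨p, Fact.out⟩).adicCompletion ℚ) (w₀.1.adicCompletion L)))))
          (hexw : ∀ z : contOneCocycles (localRationalTateRep W p ((galRestrictPlace ((Rat.HeightOneSpectrum.primesEquiv (R := 𝓞 ℚ)).symm ⟨p, Fact.out⟩)).comp
              (absGaloisRestrict (((Rat.HeightOneSpectrum.primesEquiv (R := 𝓞 ℚ)).symm ⟨p, Fact.out⟩).adicCompletion ℚ) (w₀.1.adicCompletion L)))).toTopRep,
            (bdRPeriodRingData (LocalField.valuation_adicCompletion_natCast_lt_one w₀.1 p hw₀)).HasDualExp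
              (logCyclotomic p) (localRationalTateRep W p ((galRestrictPlace ((Rat.HeightOneSpectrum.primesEquiv (R := 𝓞 ℚ)).symm ⟨p, Fact.out⟩)).comp
              (absGaloisRestrict (((Rat.HeightOneSpectrum.primesEquiv (R := 𝓞 ℚ)).symm ⟨p, Fact.out⟩).adicCompletion ℚ) (w₀.1.adicCompletion L)))) fun σ => z.1 σ)
          (h : (tateLocalRep W p (Sum.inr ((Rat.HeightOneSpectrum.primesEquiv (R := 𝓞 ℚ)).symm ⟨p, Fact.out⟩))).cohomology 1),
          (expStarOmegaHom (LocalField.valuation_adicCompletion_natCast_lt_one w₀.1 p hw₀)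
            ((galRestrictPlace ((Rat.HeightOneSpectrum.primesEquiv (R := 𝓞 ℚ)).symm ⟨p, Fact.out⟩)).comp
            (absGaloisRestrict (((Rat.HeightOneSpectrum.primesEquiv (R := 𝓞 ℚ)).symm ⟨p, Fact.out⟩).adicCompletion ℚ) (w₀.1.adicCompletion L))) dw hinjw hexw)
            (ContinuousRep.cohomologyRes (tateLocalRep W p (Sum.inr ((Rat.HeightOneSpectrum.primesEquiv (R := 𝓞 ℚ)).symm ⟨p, Fact.out⟩)))
              (absGaloisRestrict (((Rat.HeightOneSpectrum.primesEquiv (R := 𝓞 ℚ)).symm ⟨p, Fact.out⟩).adicCompletion ℚ) (w₀.1.adicCompletion L)) 1 h) =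
          algebraMap (((Rat.HeightOneSpectrum.primesEquiv (R := 𝓞 ℚ)).symm ⟨p, Fact.out⟩).adicCompletion ℚ) (w₀.1.adicCompletion L) (expStarOmegaAt d h) := by
  intro d hinj hex hdim
  -- the place instances of `ℚ_v` and `ℚ_v → L_{w₀}`
  haveI : Fact (((p : ℕ) : 𝓞 ℚ) ∈ ((Rat.HeightOneSpectrum.primesEquiv (R := 𝓞 ℚ)).symm ⟨p, Fact.out⟩).asIdeal) := ⟨hv₀⟩
  letI := valuativeRelPlace ((Rat.HeightOneSpectrum.primesEquiv (R := 𝓞 ℚ)).symm ⟨p, Fact.out⟩)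
  letI := topologicalSpacePlace ((Rat.HeightOneSpectrum.primesEquiv (R := 𝓞 ℚ)).symm ⟨p, Fact.out⟩)
  haveI := isNonarchimedeanLocalField_place ((Rat.HeightOneSpectrum.primesEquiv (R := 𝓞 ℚ)).symm ⟨p, Fact.out⟩)
  haveI := charZero_place ((Rat.HeightOneSpectrum.primesEquiv (R := 𝓞 ℚ)).symm ⟨p, Fact.out⟩)
  letI := padicAlgebraPlace p ((Rat.HeightOneSpectrum.primesEquiv (R := 𝓞 ℚ)).symm ⟨p, Fact.out⟩)
  haveI := fact_not_isUnit_place p ((Rat.HeightOneSpectrum.primesEquiv (R := 𝓞 ℚ)).symm ⟨p, Fact.out⟩)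
  haveI := isAdicComplete_place p ((Rat.HeightOneSpectrum.primesEquiv (R := 𝓞 ℚ)).symm ⟨p, Fact.out⟩)
  letI := LocalField.charZero_adicCompletion w₀.1
  letI := LocalField.adicCompletionPadicAlgebra w₀.1 p hw₀
  haveI : Fact (¬ IsUnit ((p : ℕ) : integerC (w₀.1.adicCompletion L))) :=
    ⟨not_isUnit_natCast_integerC (LocalField.valuation_adicCompletion_natCast_lt_one w₀.1 p hw₀)⟩
  haveI := isAdicComplete_integerC_natCast (LocalField.valuation_adicCompletion_natCast_lt_one w₀.1 p hw₀)
  letI instKL : Algebra (Place.Completion (Sum.inr ((Rat.HeightOneSpectrum.primesEquiv (R := 𝓞 ℚ)).symm ⟨p, Fact.out⟩)))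
      (w₀.1.adicCompletion L) :=
    (inferInstance : Algebra (((Rat.HeightOneSpectrum.primesEquiv (R := 𝓞 ℚ)).symm ⟨p, Fact.out⟩).adicCompletion ℚ)
      (w₀.1.adicCompletion L))
  have hcont : Continuous (algebraMap (Place.Completion (Sum.inr ((Rat.HeightOneSpectrum.primesEquiv (R := 𝓞 ℚ)).symm ⟨p, Fact.out⟩)))
      (w₀.1.adicCompletion L)) :=
    w₀.adicCompletionSemialgHom_continuous ℚ L
  haveI := isScalarTower_padic_place_adicCompletion' p L w₀ hv₀ hw₀ hcont
  obtain ⟨dw, hdw⟩ := exists_localNeronLine_expStarOmega_res (p := p)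
    (valuation_place_lt_one p ((Rat.HeightOneSpectrum.primesEquiv (R := 𝓞 ℚ)).symm ⟨p, Fact.out⟩))
    (LocalField.valuation_adicCompletion_natCast_lt_one w₀.1 p hw₀) W
    (galRestrictPlace ((Rat.HeightOneSpectrum.primesEquiv (R := 𝓞 ℚ)).symm ⟨p, Fact.out⟩)) hcont d hdim
  refine ⟨dw, fun hinjw hexw h => ?_⟩
  rw [expStarOmegaHom_apply]
  exact hdw hinj hinjw hex h

/-! ## §3. The same from `nonempty_neronDeRhamDatum` by name -/

set_option backward.isDefEq.respectTransparency false in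
/-- **(RES₀) ⟸ `nonempty_neronDeRhamDatum`** (the tree's named fact «`dim D⁰_dR(V_pW ×_ℚ L) = 1` over every
`p`-adic field», taken as a hypothesis — CONDITIONAL): the `Nonempty` input of §2 is w2-c2's
`nonempty_localNeronLine_comp_of_nonempty_neronDeRhamDatum` at `K₁ = ℚ_v`, `L = L_{w₀}`.
[cite: Kato1993LNM1553, Ch. II §1.2.4, Prop. 1.2.3 and Ex. 1.3.5] [cite: BrinonConrad2009, Prop. 6.3.8] -/
theorem exists_localNeronLine_res_single_of_neronDeRhamDatum (hND : nonempty_neronDeRhamDatum) :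
    haveI : Fact (((p : ℕ) : 𝓞 ℚ) ∈ ((Rat.HeightOneSpectrum.primesEquiv (R := 𝓞 ℚ)).symm ⟨p, Fact.out⟩).asIdeal) := ⟨hv₀⟩
    letI := valuativeRelPlace ((Rat.HeightOneSpectrum.primesEquiv (R := 𝓞 ℚ)).symm ⟨p, Fact.out⟩)
    letI := topologicalSpacePlace ((Rat.HeightOneSpectrum.primesEquiv (R := 𝓞 ℚ)).symm ⟨p, Fact.out⟩)
    haveI := isNonarchimedeanLocalField_place ((Rat.HeightOneSpectrum.primesEquiv (R := 𝓞 ℚ)).symm ⟨p, Fact.out⟩)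
    haveI := charZero_place ((Rat.HeightOneSpectrum.primesEquiv (R := 𝓞 ℚ)).symm ⟨p, Fact.out⟩)
    letI := padicAlgebraPlace p ((Rat.HeightOneSpectrum.primesEquiv (R := 𝓞 ℚ)).symm ⟨p, Fact.out⟩)
    haveI := fact_not_isUnit_place p ((Rat.HeightOneSpectrum.primesEquiv (R := 𝓞 ℚ)).symm ⟨p, Fact.out⟩)
    haveI := isAdicComplete_place p ((Rat.HeightOneSpectrum.primesEquiv (R := 𝓞 ℚ)).symm ⟨p, Fact.out⟩)
    letI := LocalField.charZero_adicCompletion w₀.1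
    letI := LocalField.adicCompletionPadicAlgebra w₀.1 p hw₀
    haveI : Fact (¬ IsUnit ((p : ℕ) : integerC (w₀.1.adicCompletion L))) :=
      ⟨not_isUnit_natCast_integerC (LocalField.valuation_adicCompletion_natCast_lt_one w₀.1 p hw₀)⟩
    haveI := isAdicComplete_integerC_natCast (LocalField.valuation_adicCompletion_natCast_lt_one w₀.1 p hw₀)
    ∀ (d : LocalNeronLineAt W p ((Rat.HeightOneSpectrum.primesEquiv (R := 𝓞 ℚ)).symm ⟨p, Fact.out⟩))
      (hinj : (bdRPeriodRingData (valuation_place_lt_one p ((Rat.HeightOneSpectrum.primesEquiv (R := 𝓞 ℚ)).symm ⟨p, Fact.out⟩))).CupLogInjective (logCyclotomic p)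
        (localRationalTateRep W p (galRestrictPlace ((Rat.HeightOneSpectrum.primesEquiv (R := 𝓞 ℚ)).symm ⟨p, Fact.out⟩))))
      (hex : ∀ z : contOneCocycles (localRationalTateRep W p (galRestrictPlace ((Rat.HeightOneSpectrum.primesEquiv (R := 𝓞 ℚ)).symm ⟨p, Fact.out⟩))).toTopRep,
        (bdRPeriodRingData (valuation_place_lt_one p ((Rat.HeightOneSpectrum.primesEquiv (R := 𝓞 ℚ)).symm ⟨p, Fact.out⟩))).HasDualExp (logCyclotomic p)
          (localRationalTateRep W p (galRestrictPlace ((Rat.HeightOneSpectrum.primesEquiv (R := 𝓞 ℚ)).symm ⟨p, Fact.out⟩))) fun σ => z.1 σ),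
      ∃ dw : LocalNeronLine W (LocalField.valuation_adicCompletion_natCast_lt_one w₀.1 p hw₀)
          ((galRestrictPlace ((Rat.HeightOneSpectrum.primesEquiv (R := 𝓞 ℚ)).symm ⟨p, Fact.out⟩)).comp
            (absGaloisRestrict (((Rat.HeightOneSpectrum.primesEquiv (R := 𝓞 ℚ)).symm ⟨p, Fact.out⟩).adicCompletion ℚ) (w₀.1.adicCompletion L))),
        ∀ (hinjw : (bdRPeriodRingData (LocalField.valuation_adicCompletion_natCast_lt_one w₀.1 p hw₀)).CupLogInjective
            (logCyclotomic p) (localRationalTateRep W p ((galRestrictPlace ((Rat.HeightOneSpectrum.primesEquiv (R := 𝓞 ℚ)).symm ⟨p, Fact.out⟩)).comp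
              (absGaloisRestrict (((Rat.HeightOneSpectrum.primesEquiv (R := 𝓞 ℚ)).symm ⟨p, Fact.out⟩).adicCompletion ℚ) (w₀.1.adicCompletion L)))))
          (hexw : ∀ z : contOneCocycles (localRationalTateRep W p ((galRestrictPlace ((Rat.HeightOneSpectrum.primesEquiv (R := 𝓞 ℚ)).symm ⟨p, Fact.out⟩)).comp
              (absGaloisRestrict (((Rat.HeightOneSpectrum.primesEquiv (R := 𝓞 ℚ)).symm ⟨p, Fact.out⟩).adicCompletion ℚ) (w₀.1.adicCompletion L)))).toTopRep,
            (bdRPeriodRingData (LocalField.valuation_adicCompletion_natCast_lt_one w₀.1 p hw₀)).HasDualExp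
              (logCyclotomic p) (localRationalTateRep W p ((galRestrictPlace ((Rat.HeightOneSpectrum.primesEquiv (R := 𝓞 ℚ)).symm ⟨p, Fact.out⟩)).comp
              (absGaloisRestrict (((Rat.HeightOneSpectrum.primesEquiv (R := 𝓞 ℚ)).symm ⟨p, Fact.out⟩).adicCompletion ℚ) (w₀.1.adicCompletion L)))) fun σ => z.1 σ)
          (h : (tateLocalRep W p (Sum.inr ((Rat.HeightOneSpectrum.primesEquiv (R := 𝓞 ℚ)).symm ⟨p, Fact.out⟩))).cohomology 1),
          (expStarOmegaHom (LocalField.valuation_adicCompletion_natCast_lt_one w₀.1 p hw₀)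
            ((galRestrictPlace ((Rat.HeightOneSpectrum.primesEquiv (R := 𝓞 ℚ)).symm ⟨p, Fact.out⟩)).comp
            (absGaloisRestrict (((Rat.HeightOneSpectrum.primesEquiv (R := 𝓞 ℚ)).symm ⟨p, Fact.out⟩).adicCompletion ℚ) (w₀.1.adicCompletion L))) dw hinjw hexw)
            (ContinuousRep.cohomologyRes (tateLocalRep W p (Sum.inr ((Rat.HeightOneSpectrum.primesEquiv (R := 𝓞 ℚ)).symm ⟨p, Fact.out⟩)))
              (absGaloisRestrict (((Rat.HeightOneSpectrum.primesEquiv (R := 𝓞 ℚ)).symm ⟨p, Fact.out⟩).adicCompletion ℚ) (w₀.1.adicCompletion L)) 1 h) =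
          algebraMap (((Rat.HeightOneSpectrum.primesEquiv (R := 𝓞 ℚ)).symm ⟨p, Fact.out⟩).adicCompletion ℚ) (w₀.1.adicCompletion L) (expStarOmegaAt d h) := by
  intro d hinj hex
  -- NB: no `CharZero ℚ_v` instance in scope here, so that `absGaloisRestrict ℚ ℚ_v` below is elaborated with the
  -- tree's `Place.instAlgebraCompletion` (= `galRestrictPlace`), not with `DivisionRing.toRatAlgebra`
  haveI : Fact (((p : ℕ) : 𝓞 ℚ) ∈ ((Rat.HeightOneSpectrum.primesEquiv (R := 𝓞 ℚ)).symm ⟨p, Fact.out⟩).asIdeal) := ⟨hv₀⟩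
  letI := LocalField.charZero_adicCompletion w₀.1
  letI := LocalField.adicCompletionPadicAlgebra w₀.1 p hw₀
  haveI : Fact (¬ IsUnit ((p : ℕ) : integerC (w₀.1.adicCompletion L))) :=
    ⟨not_isUnit_natCast_integerC (LocalField.valuation_adicCompletion_natCast_lt_one w₀.1 p hw₀)⟩
  haveI := isAdicComplete_integerC_natCast (LocalField.valuation_adicCompletion_natCast_lt_one w₀.1 p hw₀)
  letI instKL : Algebra (Place.Completion (Sum.inr ((Rat.HeightOneSpectrum.primesEquiv (R := 𝓞 ℚ)).symm ⟨p, Fact.out⟩)))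
      (w₀.1.adicCompletion L) :=
    (inferInstance : Algebra (((Rat.HeightOneSpectrum.primesEquiv (R := 𝓞 ℚ)).symm ⟨p, Fact.out⟩).adicCompletion ℚ)
      (w₀.1.adicCompletion L))
  refine exists_localNeronLine_res_single W p L w₀ hv₀ hw₀ d hinj hex ?_
  exact nonempty_localNeronLine_comp_of_nonempty_neronDeRhamDatum W
    (LocalField.valuation_adicCompletion_natCast_lt_one w₀.1 p hw₀)
    (Place.Completion (Sum.inr ((Rat.HeightOneSpectrum.primesEquiv (R := 𝓞 ℚ)).symm ⟨p, Fact.out⟩))) hND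

end Summit.BirchSwinnertonDyer.BirchSwinnertonDyer.Theorems.KimAtThreeFineKatoExpStarResSingle

end
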